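import Literature.AlgebraicGeometry.Resolution.CompositeValuations
import Literature.AlgebraicGeometry.Resolution.ValuedFunctionFields
import Mathlib.RingTheory.KrullDimension.Basic
import HarnessLib

/-!
# Inseparable local uniformization, §4.2 Step 1: the height-one base field of the fibration

Topic: `Literature/AlgebraicGeometry/Resolution`. M. Temkin, *Inseparable local uniformization*,
J. Algebra 373 (2013) 65–119 = arXiv:0804.1554v3, §4.2 (pp. 50–51). In the induction on the
height `h` of `K°`, "Let `F°` be the localization of `K°` whose height is `h - 1` … The image
of `K°` in `F̃` is a valuation ring. We denote it by `F̃°` … Note that the valued field `F̃` is of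
height 1" (p. 50); Step 1 chooses `k̄ = k(b) ⊆ F°` with `F̃/k̄` algebraic and provides "`k̄` with
the valuation induced from `K`" (p. 50), and Step 2 uses "`S = Spec(k̄°)`" as a base of HEIGHT
ONE (so that Lemma 3.3.2, a statement about valued fields of height one, applies; p. 51: "the
valuation on `F̃` induces a height one valuation on `m`, which agrees on `k̄ ⊂ m` with the
valuation induced by the embedding `k̄ ↪ K`"). We PROVE the valuation-theoretic facts behind
this, in the vocabulary of `CompositeValuations.lean` (`residueValuationSubring`,
`residueOverringLift`, `comapHull`):

* `exists_minimal_overring` — a valuation ring `O ≠ K` with finitely many overrings has a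
  least proper overring `O₁` (the coarsening "of height `h - 1`"); then no valuation ring lies
  strictly between `O` and `O₁` (`O₁` is an immediate coarsening).
* `residueValuationSubring_overrings_of_immediate` — for an immediate coarsening the residue
  valuation ring `W = F̃°` has no overrings other than itself and `F̃` and is not `F̃`: "`F̃` is of
  height `1`".
* `comap_eq_comap_residue` — for a subfield `E ⊆ F°` (embedded by `g : E →+* K`), the valuation
  ring induced on `E` by `K°` is the one induced by `F̃°` on the image of `E` in `F̃`.
* `krullDimLE_one_comap_of_immediate` — hence `E° = K° ∩ E` has height `≤ 1`;
* `comap_ne_top_of_isResiduallyAlgebraicOver` — and if `F̃` is algebraic over the residues of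
  `E` (Step 1: "`b̃` is a transcendence basis of `F̃` over `k`", `k̄ = k(b)`), then `E° ≠ E`, so
  `E°` has height exactly one (`ringKrullDim_comap_eq_one`).

## Source

* M. Temkin, *Inseparable local uniformization*, arXiv:0804.1554v3, §4.2, the set-up and Steps 1–2
  (pp. 50–51).
-/

noncomputable section

open IsLocalRing

namespace Literature.AlgebraicGeometry.Resolution

universe u

variable {K : Type u} [Field K]

/-! ### The immediate coarsening -/

/-- A valuation ring `O ≠ K` of finite rank has a **least proper overring** `O₁` (Temkin 2013,
§4.2, p. 50: "Let `F°` be the localization of `K°` whose height is `h - 1`"): `O < O₁` and every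
valuation ring strictly containing `O` contains `O₁`; in particular nothing lies strictly between
`O` and `O₁`. [cite: Temkin2013, Section 4.2 (p. 50)] -/
theorem exists_minimal_overring (O : ValuationSubring K) (hO : O ≠ ⊤)
    [Finite {S : ValuationSubring K // O ≤ S}] :
    ∃ O₁ : ValuationSubring K, O < O₁ ∧ (∀ S : ValuationSubring K, O < S → O₁ ≤ S) ∧
      ∀ S : ValuationSubring K, O ≤ S → S ≤ O₁ → S = O ∨ S = O₁ := by
  classical
  let T : Set {S : ValuationSubring K // O ≤ S} := {S | O < S.1}
  have hTne : T.Nonempty := ⟨⟨⊤, le_top⟩, lt_top_iff_ne_top.mpr hO⟩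
  obtain ⟨m, hmT, hmin⟩ := (Set.toFinite T).exists_minimal hTne
  refine ⟨m.1, hmT, fun S hS => ?_, fun S hOS hSm => ?_⟩
  · -- `m` is minimal in a linear order, hence least
    rcases le_total m ⟨S, hS.le⟩ with h | h
    · exact h
    · exact hmin hS h
  · rcases hOS.eq_or_lt with h | h
    · exact Or.inl h.symm
    · refine Or.inr (le_antisymm hSm ?_)
      rcases le_total m ⟨S, hOS⟩ with h' | h'
      · exact h'
      · exact hmin h h'

/-- The lift of the residue valuation ring `O/𝔪_{O₁}` itself is `O`. [folklore] -/
theorem residueOverringLift_residueValuationSubring (O O₁ : ValuationSubring K) (h : O ≤ O₁) :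
    residueOverringLift O₁ (residueValuationSubring O O₁ h) = O := by
  ext x
  rw [mem_residueOverringLift_iff]
  constructor
  · rintro ⟨hx, hres⟩
    exact (residue_mem_residueValuationSubring_iff O O₁ h ⟨x, hx⟩).mp hres
  · intro hx
    exact ⟨h hx, (residue_mem_residueValuationSubring_iff O O₁ h ⟨x, h hx⟩).mpr hx⟩

/-- The lift of the whole residue field is `O₁`. [folklore] -/
theorem residueOverringLift_top (O₁ : ValuationSubring K) :
    residueOverringLift O₁ ⊤ = O₁ := by
  ext x
  rw [mem_residueOverringLift_iff]
  exact ⟨fun ⟨hx, _⟩ => hx, fun hx => ⟨hx, ValuationSubring.mem_top _⟩⟩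

/-- **The residue valuation ring of an immediate coarsening has height one** (Temkin 2013,
§4.2, p. 50: "Note that the valued field `F̃` is of height 1"): if no valuation ring lies
strictly between `O` and `O₁`, then every overring of `W = O/𝔪_{O₁} ⊆ F̃ = O₁/𝔪_{O₁}` is `W`
or `F̃`. [cite: Temkin2013, Section 4.2 (p. 50)] -/
theorem residueValuationSubring_overrings_of_immediate (O O₁ : ValuationSubring K) (h : O ≤ O₁)
    (himm : ∀ S : ValuationSubring K, O ≤ S → S ≤ O₁ → S = O ∨ S = O₁)
    (S' : ValuationSubring (ResidueField O₁)) (hS' : residueValuationSubring O O₁ h ≤ S') :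
    S' = residueValuationSubring O O₁ h ∨ S' = ⊤ := by
  have hinj := overringsResidueEmb_injective O O₁ h
  rcases himm (residueOverringLift O₁ S') (le_residueOverringLift O O₁ h S' hS')
      (residueOverringLift_le O₁ S') with hS | hS
  · left
    have := @hinj ⟨S', hS'⟩ ⟨residueValuationSubring O O₁ h, le_rfl⟩ (Subtype.ext (by
      change residueOverringLift O₁ S' = residueOverringLift O₁ (residueValuationSubring O O₁ h)
      rw [hS, residueOverringLift_residueValuationSubring]))
    exact congrArg Subtype.val this
  · right
    have := @hinj ⟨S', hS'⟩ ⟨⊤, le_top⟩ (Subtype.ext (by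
      change residueOverringLift O₁ S' = residueOverringLift O₁ ⊤
      rw [hS, residueOverringLift_top]))
    exact congrArg Subtype.val this

/-- The residue valuation ring of a PROPER coarsening is a proper valuation ring of the residue
field (`F̃° ≠ F̃`). [folklore] -/
theorem residueValuationSubring_ne_top (O O₁ : ValuationSubring K) (h : O ≤ O₁) (hne : O ≠ O₁) :
    residueValuationSubring O O₁ h ≠ ⊤ := by
  intro htop
  apply hne
  rw [← residueOverringLift_residueValuationSubring O O₁ h, htop, residueOverringLift_top]

/-! ### The valuation induced on a subfield of the coarsening -/

section subfield

variable (O O₁ : ValuationSubring K) (h : O ≤ O₁) {E : Type u} [Field E] (g : E →+* K)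
  (hg : ∀ z : E, g z ∈ O₁)

/-- The embedding of a subfield `E ⊆ F°` into the residue field `F̃ = F°/𝔪_{F°}` (in the paper:
`k̄ ⊆ F°`, "`F` induces a trivial valuation on `k̄`", and `k̄ ↪ F̃`). [folklore] -/
def residueEmbedding : E →+* ResidueField O₁ :=
  (residue O₁).comp (g.codRestrict O₁ hg)

/-- `residueEmbedding g z` is the residue of `g z`. [folklore] -/
@[simp] theorem residueEmbedding_apply (z : E) :
    residueEmbedding O₁ g hg z = residue O₁ ⟨g z, hg z⟩ := rfl

/-- **The valuation induced by `K°` on a subfield `E ⊆ F°` is the one induced by `F̃°` on the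
image of `E` in `F̃`** (Temkin 2013, §4.2, Step 2, p. 51: "the valuation on `F̃` induces a height
one valuation on `m`, which agrees on `k̄ ⊂ m` with the valuation induced by the embedding
`k̄ ↪ K`"): `z ∈ K°` iff the residue of `z` lies in `F̃° = K°/𝔪_{F°}`.
[cite: Temkin2013, Section 4.2, Step 2 (p. 51)] -/
theorem comap_eq_comap_residue :
    O.comap g = (residueValuationSubring O O₁ h).comap (residueEmbedding O₁ g hg) := by
  ext z
  rw [ValuationSubring.mem_comap, ValuationSubring.mem_comap, residueEmbedding_apply,
    residue_mem_residueValuationSubring_iff]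

include h hg in
/-- **`E° = K° ∩ E` has height at most one when `F°` is an immediate coarsening of `K°`**
(Temkin 2013, §4.2, Step 2: the base `S = Spec(k̄°)` is of height one): the overrings of `E°`
embed into those of `F̃°` (`overringsComapEmb`, via `comap_eq_comap_residue`), which are only
`F̃°` and `F̃`; so `E°` has at most two overrings and every non-zero prime of `E°` is maximal.
[cite: Temkin2013, Section 4.2, Step 2 (p. 51)] -/
theorem krullDimLE_one_comap_of_immediate
    (himm : ∀ S : ValuationSubring K, O ≤ S → S ≤ O₁ → S = O ∨ S = O₁) :
    Ring.KrullDimLE 1 (O.comap g) := by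
  classical
  set W := residueValuationSubring O O₁ h with hW
  set ι := residueEmbedding O₁ g hg with hι
  have hcomap : O.comap g = W.comap ι := comap_eq_comap_residue O O₁ h g hg
  set OE := O.comap g with hOE
  refine Ring.KrullDimLE.mk₁' fun I hI0 hI => ?_
  -- if `I` were a non-zero non-maximal prime, `⊥ < I < 𝔪` would give three overrings of `E°`
  by_contra hImax
  haveI := hI
  have hIne : I ≠ maximalIdeal OE := fun heq =>
    hImax (heq ▸ IsLocalRing.maximalIdeal.isMaximal OE)
  haveI : (⊥ : Ideal OE).IsPrime := Ideal.isPrime_bot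
  have hbm : (⊥ : Ideal OE) ≠ maximalIdeal OE := fun hb =>
    hI0 (le_bot_iff.mp (hb ▸ IsLocalRing.le_maximalIdeal hI.ne_top))
  let p₀ : PrimeSpectrum OE := ⟨⊥, inferInstance⟩
  let p₁ : PrimeSpectrum OE := ⟨I, hI⟩
  let p₂ : PrimeSpectrum OE := ⟨maximalIdeal OE, inferInstance⟩
  have h01 : p₀ ≠ p₁ := fun heq => hI0 (congrArg PrimeSpectrum.asIdeal heq).symm
  have h12 : p₁ ≠ p₂ := fun heq => hIne (congrArg PrimeSpectrum.asIdeal heq)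
  have h02 : p₀ ≠ p₂ := fun heq => hbm (congrArg PrimeSpectrum.asIdeal heq)
  -- primes of `OE` ↔ overrings of `OE` ↪ overrings of `W`, of which there are at most two
  let emb : PrimeSpectrum OE → {S' // W ≤ S'} := fun p =>
    overringsComapEmb W ι ⟨(OE.primeSpectrumEquiv p).1, by
      rw [← hcomap]; exact (OE.primeSpectrumEquiv p).2⟩
  have hemb : Function.Injective emb := by
    intro p p' hpp'
    have h1 := overringsComapEmb_injective W ι hpp'
    have h2 : (OE.primeSpectrumEquiv p).1 = (OE.primeSpectrumEquiv p').1 :=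
      congrArg (fun S : {T' // W.comap ι ≤ T'} => S.1) h1
    exact OE.primeSpectrumEquiv.injective (Subtype.ext h2)
  have htwo : ∀ S : {S' // W ≤ S'}, S = ⟨W, le_rfl⟩ ∨ S = ⟨⊤, le_top⟩ := fun S => by
    rcases residueValuationSubring_overrings_of_immediate O O₁ h himm S.1 S.2 with hS | hS
    · exact Or.inl (Subtype.ext hS)
    · exact Or.inr (Subtype.ext hS)
  -- pigeonhole on three values in a two-element type
  rcases htwo (emb p₀) with e0 | e0 <;> rcases htwo (emb p₁) with e1 | e1 <;>
    rcases htwo (emb p₂) with e2 | e2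
  · exact h01 (hemb (e0.trans e1.symm))
  · exact h01 (hemb (e0.trans e1.symm))
  · exact h02 (hemb (e0.trans e2.symm))
  · exact h12 (hemb (e1.trans e2.symm))
  · exact h12 (hemb (e1.trans e2.symm))
  · exact h02 (hemb (e0.trans e2.symm))
  · exact h01 (hemb (e0.trans e1.symm))
  · exact h01 (hemb (e0.trans e1.symm))

include h in
/-- **`E° ≠ E` when `F̃` is algebraic over the residues of `E`** (Temkin 2013, §4.2, Step 1: `k̄`
with `F̃/k̄` algebraic; then `K°` does not contain `k̄`, for otherwise `F̃° ⊇ k̄` would be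
integrally closed under the algebraic `F̃`, forcing `F̃° = F̃`, i.e. `K° = F°`). Here `O ≠ O₁`.
[cite: Temkin2013, Section 4.2, Step 1 (p. 50)] -/
theorem comap_ne_top_of_isResiduallyAlgebraicOver (hne : O ≠ O₁)
    (hres : IsResiduallyAlgebraicOver O₁ g.fieldRange ⊤) : O.comap g ≠ ⊤ := by
  intro htop
  apply residueValuationSubring_ne_top O O₁ h hne
  set W := residueValuationSubring O O₁ h with hW
  -- the residue field of `E` lies in `W`
  have hEW : ∀ r ∈ resField O₁ g.fieldRange, r ∈ W := by
    intro r hr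
    obtain ⟨a, haE, rfl⟩ := (mem_resField_iff O₁ _ r).mp hr
    obtain ⟨z, hz⟩ := RingHom.mem_fieldRange.mp haE
    rw [residue_mem_residueValuationSubring_iff]
    have : z ∈ O.comap g := by rw [htop]; exact ValuationSubring.mem_top z
    rw [ValuationSubring.mem_comap, hz] at this
    exact this
  -- every element of the residue field is algebraic over it, hence integral over `W`
  rw [eq_top_iff]
  intro x _
  have hx : IsAlgebraic (resField O₁ g.fieldRange) x := hres x (by
    obtain ⟨y, rfl⟩ := residue_surjective x
    exact residue_mem_resField O₁ y (Subfield.mem_top _))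
  have hxi : IsIntegral (resField O₁ g.fieldRange) x := hx.isIntegral
  -- transfer integrality to `W ⊇ resField`
  letI : Algebra (resField O₁ g.fieldRange) W :=
    ((resField O₁ g.fieldRange).subtype.codRestrict W fun r => hEW r r.2).toAlgebra
  haveI : IsScalarTower (resField O₁ g.fieldRange) W (ResidueField O₁) :=
    IsScalarTower.of_algebraMap_eq (fun _ => rfl)
  have hxW : IsIntegral W x := hxi.tower_top
  obtain ⟨y, rfl⟩ := IsIntegrallyClosed.algebraMap_eq_of_integral hxW
  exact y.2

include h hg in
/-- Hence **`E°` has height exactly one** in the situation of §4.2 (immediate coarsening,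
`E ⊆ F°`, `F̃` algebraic over the residues of `E`, `K° ≠ F°`): `ringKrullDim E° = 1`.
[cite: Temkin2013, Section 4.2, Steps 1–2 (pp. 50–51)] -/
theorem ringKrullDim_comap_eq_one (hne : O ≠ O₁)
    (himm : ∀ S : ValuationSubring K, O ≤ S → S ≤ O₁ → S = O ∨ S = O₁)
    (hres : IsResiduallyAlgebraicOver O₁ g.fieldRange ⊤) :
    ringKrullDim (O.comap g) = 1 := by
  haveI := krullDimLE_one_comap_of_immediate O O₁ h g hg himm
  have hle : ringKrullDim (O.comap g) ≤ 1 := Ring.krullDimLE_iff.mp ‹_›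
  have hne' := comap_ne_top_of_isResiduallyAlgebraicOver O O₁ h g hne hres
  -- a valuation ring which is not a field has a non-zero maximal ideal: dimension `≥ 1`
  refine le_antisymm hle ?_
  have hbot : (⊥ : Ideal (O.comap g)) ≠ maximalIdeal (O.comap g) := by
    intro hb
    apply hne'
    rw [eq_top_iff]
    intro z _
    by_contra hz
    have hzi : z⁻¹ ∈ O.comap g := ((O.comap g).mem_or_inv_mem z).resolve_left hz
    have hz0 : z ≠ 0 := by rintro rfl; exact hz (O.comap g).zero_mem
    have hunit : ¬ IsUnit (⟨z⁻¹, hzi⟩ : O.comap g) := by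
      intro hu
      apply hz
      have := inv_mem_of_isUnit (O.comap g) hzi hu
      rw [inv_inv] at this
      exact this
    have hmem : (⟨z⁻¹, hzi⟩ : O.comap g) ∈ maximalIdeal (O.comap g) :=
      (IsLocalRing.mem_maximalIdeal _).mpr hunit
    rw [← hb] at hmem
    have : (z⁻¹ : E) = 0 := congrArg Subtype.val (Ideal.mem_bot.mp hmem)
    exact inv_ne_zero hz0 this
  haveI : (⊥ : Ideal (O.comap g)).IsPrime := Ideal.isPrime_bot
  have hlt : (⟨⊥, inferInstance⟩ : PrimeSpectrum (O.comap g)) <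
      ⟨maximalIdeal (O.comap g), inferInstance⟩ :=
    lt_of_le_of_ne bot_le (fun heq => hbot (congrArg PrimeSpectrum.asIdeal heq))
  have := Order.one_le_krullDim_iff.mpr ⟨_, _, hlt⟩
  exact this

end subfield

end Literature.AlgebraicGeometry.Resolution
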